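import Literature.AlgebraicGeometry.Kawanoue2007.IdealisticFiltration
import Literature.AlgebraicGeometry.Resolution.RegularLocalOrderValuation
import Literature.RingTheory.HilbertSamuel.LocalRing
import Mathlib.RingTheory.Localization.AtPrime.Basic
import Mathlib.RingTheory.Spectrum.Prime.Basic
import Mathlib.RingTheory.LocalRing.ResidueField.Basic
import Mathlib.Data.Real.ENatENNReal
import Mathlib.Data.ENNReal.Inv
import Mathlib.LinearAlgebra.LinearIndependent.Defs
import Mathlib.LinearAlgebra.Dimension.Constructions
import HarnessLib

/-!
# Kawanoue 2007, Part I, Def. 2.1.1.1 (5)(6) and Chapter 3 §3.1: multiplicity `μ_P`, support, leading algebra pieces `L(𝕀)_n`, pure part, leading generator system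

H. Kawanoue, *Toward resolution of singularities over a field of positive characteristic. Part I.
Foundation; the language of the idealistic filtration*, Publ. RIMS **43** (2007) 819–909
(= arXiv:math/0607009) [Kawanoue2007]. Sequel of `IdealisticFiltration.lean`. This file types the
POINTWISE notions: Definition 2.1.1.1 (5)(6) (`μ_P(T)`, `Supp(T)`), Definition 3.1.1.1 (the degree-`n`
piece `L(𝕀)_n` of the leading algebra at the closed point and its pure part), Definition 3.1.3.1
(leading generator system), Remark 3.1.3.3 (2) (its weak form) and Definition 3.2.1.1 (the invariant `σ`),
as REAL Lean definitions; NO named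
facts are introduced (in particular Prop. 3.1.3.2, the EXISTENCE of a leading generator system for a
𝔇-saturated filtration over an algebraically closed field, is a theorem in print that is neither
asserted nor assumed here). Locators = printed item numbers; pages re-read on the held arXiv text
(`lit read paper:arxiv-math-0607009`, chunks p0051, p0077–p0083). Campaign `res-hironaka` (D-0089),
rung LIT-6; consumer: rescue catalogue row RR-133 («leading generator system as a collective
substitute for a hypersurface of maximal contact», OURS device).

## What is typed, and how (faithfulness notes)

* **Def. 2.1.1.1 (5)(6).** «`μ_P(T) := inf { μ_P(f, a) := ord_P(f)/a ; (f, a) ∈ T, a > 0 }`» and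
  «`Supp(T) = {P ∈ Spec R ; μ_P(T) ≥ 1}`». `ordAt P f = ord_P(f)` is the order of `f` in the local
  ring `R_P` (the tree's `Resolution.adicOrder` in `Localization.AtPrime P`, value in `ℕ∞`, `ord 0 = ∞`);
  `muElem P f a = ord_P(f)/a ∈ [0, ∞]` (typed in `ℝ≥0∞`; only used for `a > 0`, as printed — for
  `a ≤ 0` the value is a documented junk value), `mu P T` the infimum over `{(f, a) ∈ T ; a > 0}`
  (`= ∞` for the empty index set, the lattice convention), `supp T ⊂ PrimeSpectrum R`; for an
  idealistic filtration, `𝕀.mu P := mu P 𝕀.carrier` and `𝕀.supp` (Rem. 2.1.1.2 (2)).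
* **Setting of Chapter 3 (p0077).** «`R` is taken to be the localization at a maximal ideal
  corresponding to a closed point `P ∈ W` of the coordinate ring of an affine open subset of a variety
  `W` smooth over an algebraically closed field `k` …, or its completion. We denote by `𝔪` the maximal
  ideal of `R`», `G = ⊕_n 𝔪ⁿ/𝔪ⁿ⁺¹`. We type over ANY local ring `(R, 𝔪)`, with `G_n = 𝔪ⁿ/𝔪ⁿ⁺¹` the
  tree's `HilbertSamuel.gradedPiece (maximalIdeal R) n`, a vector space over the residue field
  `F = R/𝔪` (`= k` in the printed setting). Mathlib has no associated graded RING, so the graded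
  algebra `L(𝕀) = ⊕ L(𝕀)_n ⊂ G` is typed DEGREEWISE: products/powers of classes are taken on
  representatives (`[h]^{q} := [h^{q}]`), which is how the multiplication of `G` is defined.
* **Def. 3.1.1.1 (1).** `leadingModule 𝕀 n = L(𝕀)_n = { f̄ = (f mod 𝔪ⁿ⁺¹) ; (f, n) ∈ 𝕀, f ∈ 𝔪ⁿ }`, an
  `F`-subspace of `G_n`; `leadingModule_zero` = «`L(𝕀)_0 = k` by condition (o)».
* **Def. 3.1.1.1 (2).** `IsPure q w`: `w ∈ G_q` «is pure», i.e. `w = v̄^q` for some `v̄ ∈ G_1`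
  (`∃ v ∈ 𝔪, w = [v^q]`); `pureLeading 𝕀 q = L(𝕀)_q^{pure} = L(𝕀)_q ∩ F^e(G_1)` for `q = p^e`, as a
  SUBSET of `G_q` (a subspace when `k` is perfect, p0080 l.1–3 — not proved here). Kawanoue's «`p`» is
  `char k` if positive and the symbol `∞` in characteristic zero with `∞^0 = 1`, `∞^n = ∞` (Rem.
  3.1.1.2), so that only `e = 0`, `q = 1` occurs there; we let the consumer pass `p : ℕ` and document
  that `p = 1` (the exponential characteristic) reproduces the characteristic-zero convention
  literally: every `p^e = 1`, the only pure part is `L(𝕀)_1^{pure} = L(𝕀)_1`.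
* **Def. 3.1.3.1.** `IsLGS p 𝕀 h e`: a family `ℍ = {(h_i, p^{e_i})}_{i ∈ ι} ⊂ 𝕀` (printed double
  index `ij` flattened to one index type `ι`) with (i) `h_i ∈ 𝔪^{p^{e_i}}` and `h̄_i ∈
  L(𝕀)^{pure}_{p^{e_i}}`, (ii) for every `e`, `{h̄_i^{p^{e − e_i}} ; e_i ≤ e}` «consists of
  `#{i ; e_i ≤ e}` distinct elements, and forms a basis of `L(𝕀)^{pure}_{p^e}`» — typed as: the family
  `lgsFamily … e` on `{i ; e_i ≤ e}` is injective, `F`-linearly independent, and its `F`-span has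
  underlying set `pureLeading 𝕀 (p^e)`. Printed for a 𝔇-saturated `𝕀`; the predicate itself does not
  mention 𝔇-saturation (consumers add `IsDSaturated`). **Rem. 3.1.3.3 (2)** `IsWeakLGS`: (i) and
  linear independence only.
* **Def. 3.2.1.1.** `lPure 𝕀 q = l^{pure}_q = dim_F L(𝕀)^{pure}_q` (typed as the dimension of the
  `F`-span of the pure part), `sigma p d 𝕀 : ℕ → ℤ`, `σ(e) = d − l^{pure}_{p^e}` with `d = dim W` passed
  as a parameter (in print `l^{pure}_{p^e} ≤ dim W`, so `σ(e) ∈ ℤ_{≥0}`; we do not prove that bound and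
  keep `ℤ` values — no truncated subtraction); `IsLGS.lPure_eq_card`: for a leading generator system,
  `l^{pure}_{p^e} = #{i ; e_i ≤ e}` (condition (ii)). The printed warning that `σ` is later modified
  (boundary divisor, §3.2 preamble) applies.

Deliberately NOT here: Prop. 3.1.3.2 (existence; via Lemma 3.1.2.1 = the tree's
`Resolution/DiffStableSubalgebra.lean` for perfect `k`), Rem. 3.1.3.3 (1) (`Diff^{(p^e)}_R`), §3.2.2
(`μ̃`; polynomial-model versions of `σ`, `μ̃` exist in `Resolution/PointBlowupIFPUnit.lean`), Lemma 1.2.3.1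
(`ord_P(I) ≥ n ⟺ P ∈ V(Diff^{n−1}(I))`). Nothing of Hironaka's 2017 manuscript is referred to or
asserted.

## References

* H. Kawanoue, Publ. RIMS 43 (2007) 819–909 = arXiv:math/0607009: Def. 2.1.1.1 (5)(6), Rem.
  2.1.1.2 (2), Def. 3.1.1.1, Rem. 3.1.1.2, Def. 3.1.3.1, Rem. 3.1.3.3 (2), Def. 3.2.1.1. [Kawanoue2007]
* V. Cossart, U. Jannsen, S. Saito, LNM 2270 (2020), §2.2 (the tree's `gradedPiece`).
  [CossartJannsenSaito2020]
-/

noncomputable section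

namespace Literature.AlgebraicGeometry.Kawanoue2007

open Literature.AlgebraicGeometry.Resolution (adicOrder le_adicOrder_iff)
open Literature.RingTheory.HilbertSamuel (gradedPiece gradedPiece.mk)
open IsLocalRing
open scoped ENNReal

/-! ## Def. 2.1.1.1 (5)(6): the multiplicity `μ_P` and the support -/

section Multiplicity

variable {R : Type*} [CommRing R]

/-- `ord_P(f)`, the order of `f` at the point `P ∈ Spec R`: the `PR_P`-adic order of the image of
`f` in the local ring `R_P` (`sup {n ; f ∈ Pⁿ R_P} ∈ ℕ∞`, `ord_P(0) = ∞`).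
[cite: Kawanoue2007, Def. 2.1.1.1 (5)] -/
def ordAt (P : Ideal R) [P.IsPrime] (f : R) : ℕ∞ :=
  adicOrder (algebraMap R (Localization.AtPrime P) f)

/-- `n ≤ ord_P(f) ⟺ f ∈ Pⁿ R_P`. [cite: Kawanoue2007, Def. 2.1.1.1 (5)] -/
theorem le_ordAt_iff (P : Ideal R) [P.IsPrime] (f : R) (n : ℕ) :
    (n : ℕ∞) ≤ ordAt P f ↔
      algebraMap R (Localization.AtPrime P) f ∈ maximalIdeal (Localization.AtPrime P) ^ n :=
  le_adicOrder_iff _ n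

/-- `μ_P(f, a) := ord_P(f)/a` (for `a > 0`; value in `[0, ∞]`, `= ∞` iff `ord_P(f) = ∞`). For
`a ≤ 0` this is a junk value (`ENNReal.ofReal a = 0`), never used: the printed convention
«`μ_P(f, 0) = ∞`» is not needed since `μ_P(T)` ranges over `a > 0` only.
[cite: Kawanoue2007, Def. 2.1.1.1 (5)] -/
def muElem (P : Ideal R) [P.IsPrime] (f : R) (a : ℝ) : ℝ≥0∞ :=
  ((ordAt P f : ℕ∞) : ℝ≥0∞) / ENNReal.ofReal a

/-- **`μ_P(T) := inf { ord_P(f)/a ; (f, a) ∈ T, a > 0 }`**, the multiplicity of `T ⊂ R × ℝ_{≥0}`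
at `P` (`inf ∅ = ∞`). [cite: Kawanoue2007, Def. 2.1.1.1 (5)] -/
def mu (P : Ideal R) [P.IsPrime] (T : Set (R × ℝ)) : ℝ≥0∞ :=
  ⨅ x ∈ {x : R × ℝ | x ∈ T ∧ 0 < x.2}, muElem P x.1 x.2

/-- `μ_P(T) ≤ ord_P(f)/a` for every `(f, a) ∈ T` with `a > 0`. [cite: Kawanoue2007, Def. 2.1.1.1 (5)] -/
theorem mu_le_muElem (P : Ideal R) [P.IsPrime] {T : Set (R × ℝ)} {f : R} {a : ℝ}
    (h : (f, a) ∈ T) (ha : 0 < a) : mu P T ≤ muElem P f a :=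
  iInf₂_le (f, a) ⟨h, ha⟩

/-- `c ≤ μ_P(T) ⟺ c ≤ ord_P(f)/a` for all `(f, a) ∈ T`, `a > 0`. [cite: Kawanoue2007, Def. 2.1.1.1 (5)] -/
theorem le_mu_iff (P : Ideal R) [P.IsPrime] {T : Set (R × ℝ)} {c : ℝ≥0∞} :
    c ≤ mu P T ↔ ∀ (f : R) (a : ℝ), (f, a) ∈ T → 0 < a → c ≤ muElem P f a := by
  simp only [mu, le_iInf_iff, Set.mem_setOf_eq, and_imp, Prod.forall]

/-- **`Supp(T) := {P ∈ Spec R ; μ_P(T) ≥ 1}`**. [cite: Kawanoue2007, Def. 2.1.1.1 (6)] -/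
def supp (T : Set (R × ℝ)) : Set (PrimeSpectrum R) := {P | 1 ≤ mu P.asIdeal T}

/-- `P ∈ Supp(T) ⟺ 1 ≤ μ_P(T)`. [cite: Kawanoue2007, Def. 2.1.1.1 (6)] -/
@[simp] theorem mem_supp_iff {T : Set (R × ℝ)} {P : PrimeSpectrum R} : P ∈ supp T ↔ 1 ≤ mu P.asIdeal T :=
  Iff.rfl

/-- `μ_P(𝕀)` of an idealistic filtration = `μ_P` of its underlying subset of `R × ℝ`.
[cite: Kawanoue2007, Rem. 2.1.1.2 (2)] -/
abbrev IdealisticFiltration.mu (P : Ideal R) [P.IsPrime] (𝕀 : IdealisticFiltration R) : ℝ≥0∞ :=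
  Kawanoue2007.mu P 𝕀.carrier

/-- `Supp(𝕀)` of an idealistic filtration = `Supp` of its underlying subset of `R × ℝ`.
[cite: Kawanoue2007, Rem. 2.1.1.2 (2)] -/
abbrev IdealisticFiltration.supp (𝕀 : IdealisticFiltration R) : Set (PrimeSpectrum R) :=
  Kawanoue2007.supp 𝕀.carrier

end Multiplicity

/-! ## Def. 3.1.1.1: the pieces `L(𝕀)_n ⊂ 𝔪ⁿ/𝔪ⁿ⁺¹` of the leading algebra and the pure part -/

section Leading

variable {R : Type*} [CommRing R] [IsLocalRing R]

/-- **`L(𝕀)_n`**, the degree-`n` piece of the leading algebra of `𝕀` at the closed point: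
«`L(𝕀)_n = { f̄ = (f mod 𝔪ⁿ⁺¹) ; (f, n) ∈ 𝕀, f ∈ 𝔪ⁿ }`» `⊂ G_n = 𝔪ⁿ/𝔪ⁿ⁺¹`, a subspace over the
residue field. [cite: Kawanoue2007, Def. 3.1.1.1 (1)] -/
def leadingModule (𝕀 : IdealisticFiltration R) (n : ℕ) :
    Submodule (ResidueField R) (gradedPiece (maximalIdeal R) n) where
  carrier := {w | ∃ (f : R) (hf : f ∈ maximalIdeal R ^ n), f ∈ 𝕀.level n ∧
    gradedPiece.mk (maximalIdeal R) n ⟨f, hf⟩ = w}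
  zero_mem' := ⟨0, Submodule.zero_mem _, 𝕀.zero_mem_level _, map_zero _⟩
  add_mem' := by
    rintro _ _ ⟨f, hf, hfI, rfl⟩ ⟨g, hg, hgI, rfl⟩
    exact ⟨f + g, Submodule.add_mem _ hf hg, 𝕀.add_mem hfI hgI, by rw [← map_add]; rfl⟩
  smul_mem' := by
    rintro c _ ⟨f, hf, hfI, rfl⟩
    obtain ⟨r, rfl⟩ := residue_surjective c
    refine ⟨r * f, Ideal.mul_mem_left _ r hf, 𝕀.mul_mem_left r hfI, ?_⟩
    calc gradedPiece.mk (maximalIdeal R) n ⟨r * f, Ideal.mul_mem_left _ r hf⟩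
        = r • gradedPiece.mk (maximalIdeal R) n ⟨f, hf⟩ := by rw [← map_smul]; rfl
      _ = residue R r • gradedPiece.mk (maximalIdeal R) n ⟨f, hf⟩ :=
          (algebraMap_smul (ResidueField R) r _).symm

/-- Membership in `L(𝕀)_n`: classes of the `f ∈ 𝔪ⁿ` with `(f, n) ∈ 𝕀`. [cite: Kawanoue2007, Def. 3.1.1.1 (1)] -/
theorem mem_leadingModule_iff {𝕀 : IdealisticFiltration R} {n : ℕ}
    {w : gradedPiece (maximalIdeal R) n} :
    w ∈ leadingModule 𝕀 n ↔ ∃ (f : R) (hf : f ∈ maximalIdeal R ^ n), f ∈ 𝕀.level n ∧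
      gradedPiece.mk (maximalIdeal R) n ⟨f, hf⟩ = w :=
  Iff.rfl

/-- The class of `f ∈ 𝔪ⁿ ∩ 𝕀_n` lies in `L(𝕀)_n`. [cite: Kawanoue2007, Def. 3.1.1.1 (1)] -/
theorem mk_mem_leadingModule {𝕀 : IdealisticFiltration R} {n : ℕ} {f : R}
    (hf : f ∈ maximalIdeal R ^ n) (hfI : f ∈ 𝕀.level n) :
    gradedPiece.mk (maximalIdeal R) n ⟨f, hf⟩ ∈ leadingModule 𝕀 n :=
  ⟨f, hf, hfI, rfl⟩

/-- «Note that `L(𝕀)_0 = k` by condition (o)». [cite: Kawanoue2007, Def. 3.1.1.1 (1)] -/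
theorem leadingModule_zero (𝕀 : IdealisticFiltration R) : leadingModule 𝕀 0 = ⊤ := by
  refine eq_top_iff.mpr fun w _ => ?_
  obtain ⟨x, rfl⟩ := gradedPiece.mk_surjective (maximalIdeal R) 0 w
  exact ⟨x, x.2, by simpa using 𝕀.mem_level_zero (x : R), rfl⟩

/-- `L` is monotone in `𝕀`. [cite: Kawanoue2007, Def. 3.1.1.1 (1)] -/
theorem leadingModule_mono {𝕀 𝕁 : IdealisticFiltration R} (h : IdealisticFiltration.Incl 𝕀 𝕁) (n : ℕ) :
    leadingModule 𝕀 n ≤ leadingModule 𝕁 n := by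
  rintro _ ⟨f, hf, hfI, rfl⟩
  exact ⟨f, hf, h _ hfI, rfl⟩

/-- **Pure elements of degree `q`**: `w ∈ G_q` is pure if `w = v̄^q` for some `v̄ ∈ G_1`, i.e.
`w = (v^q mod 𝔪^{q+1})` for some `v ∈ 𝔪` — for `q = p^e` this is `w ∈ F^e(G_1)`, `F` the Frobenius of
`G` (in characteristic `p` the class of `v^{p^e}` depends only on `v̄`); for `q = 1` every element of
`G_1` is pure (the characteristic-zero convention `∞^0 = 1` of Rem. 3.1.1.2).
[cite: Kawanoue2007, Def. 3.1.1.1 (2)] -/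
def IsPure (q : ℕ) (w : gradedPiece (maximalIdeal R) q) : Prop :=
  ∃ (v : R) (hv : v ∈ maximalIdeal R),
    gradedPiece.mk (maximalIdeal R) q ⟨v ^ q, Ideal.pow_mem_pow hv q⟩ = w

/-- In degree `1` every class is pure. [cite: Kawanoue2007, Rem. 3.1.1.2] -/
theorem isPure_one (w : gradedPiece (maximalIdeal R) 1) : IsPure 1 w := by
  obtain ⟨⟨v, hv⟩, rfl⟩ := gradedPiece.mk_surjective (maximalIdeal R) 1 w
  exact ⟨v, by simpa using hv, by simp⟩

/-- **The pure part `L(𝕀)^{pure}_{q} = L(𝕀)_q ∩ F^e(G_1)`** (`q = p^e`), as a subset of `G_q`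
(a subspace when the residue field is perfect, p0080 — not proved here).
[cite: Kawanoue2007, Def. 3.1.1.1 (2)] -/
def pureLeading (𝕀 : IdealisticFiltration R) (q : ℕ) : Set (gradedPiece (maximalIdeal R) q) :=
  {w | w ∈ leadingModule 𝕀 q ∧ IsPure q w}

/-- Membership in the pure part. [cite: Kawanoue2007, Def. 3.1.1.1 (2)] -/
@[simp] theorem mem_pureLeading_iff {𝕀 : IdealisticFiltration R} {q : ℕ}
    {w : gradedPiece (maximalIdeal R) q} : w ∈ pureLeading 𝕀 q ↔ w ∈ leadingModule 𝕀 q ∧ IsPure q w :=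
  Iff.rfl

/-- In degree `1` the pure part is all of `L(𝕀)_1`: «`L(𝕀)^{pure}_{∞^0} = L(𝕀)^{pure}_1 = L(𝕀)_1`».
[cite: Kawanoue2007, Rem. 3.1.1.2] -/
theorem pureLeading_one (𝕀 : IdealisticFiltration R) :
    pureLeading 𝕀 1 = (leadingModule 𝕀 1 : Set (gradedPiece (maximalIdeal R) 1)) :=
  Set.ext fun w => ⟨fun h => h.1, fun h => ⟨h, isPure_one w⟩⟩

/-! ## Def. 3.1.3.1: leading generator system -/

/-- `h ∈ 𝔪^{p^{e'}} ⟹ h^{p^{e − e'}} ∈ 𝔪^{p^e}` for `e' ≤ e`. [cite: Kawanoue2007, Def. 3.1.3.1 (ii)] -/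
theorem pow_mem_pow_of_le (p : ℕ) {h : R} {e' e : ℕ} (hle : e' ≤ e)
    (hh : h ∈ maximalIdeal R ^ p ^ e') : h ^ p ^ (e - e') ∈ maximalIdeal R ^ p ^ e := by
  have := Ideal.pow_mem_pow hh (p ^ (e - e'))
  rwa [← pow_mul, ← pow_add, Nat.add_sub_cancel' hle] at this

/-- The family `{ h̄_i^{p^{e − e_i}} ; e_i ≤ e } ⊂ G_{p^e}` of condition (ii) of Def. 3.1.3.1 (powers
taken on representatives). [cite: Kawanoue2007, Def. 3.1.3.1 (ii)] -/
def lgsFamily (p : ℕ) {ι : Type*} (h : ι → R) (e : ι → ℕ)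
    (hh : ∀ i, h i ∈ maximalIdeal R ^ p ^ e i) (e₀ : ℕ) :
    {i : ι // e i ≤ e₀} → gradedPiece (maximalIdeal R) (p ^ e₀) :=
  fun i => gradedPiece.mk (maximalIdeal R) (p ^ e₀)
    ⟨h i ^ p ^ (e₀ - e i), pow_mem_pow_of_le p i.2 (hh i)⟩

/-- **Leading generator system** [Def. 3.1.3.1]: for (in print: a 𝔇-saturated) idealistic
filtration `𝕀` over the local ring `(R, 𝔪)`, a family `ℍ = {(h_i, p^{e_i})}_{i} ⊂ 𝕀` such that
«(i) `h_i ∈ 𝔪^{p^{e_i}}` and `h̄_i = (h_i mod 𝔪^{p^{e_i}+1}) ∈ L(𝕀)^{pure}_{p^{e_i}}`, (ii)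
`{h̄_i^{p^{e−e_i}} ; e_i ≤ e}` consists of `#{i ; e_i ≤ e}` distinct elements, and forms a basis of
`L(𝕀)^{pure}_{p^e}` for any `e ∈ ℤ_{≥0}`». `p` = `char k > 0`, or `1` for the characteristic-zero
convention `p = ∞` (then all `p^e = 1` and (ii) forces `e_i = 0`). The printed double index `ij` is one
index type `ι`. [cite: Kawanoue2007, Def. 3.1.3.1] -/
structure IsLGS (p : ℕ) (𝕀 : IdealisticFiltration R) {ι : Type*} (h : ι → R) (e : ι → ℕ) : Prop where
  /-- `ℍ ⊂ 𝕀`: `(h_i, p^{e_i}) ∈ 𝕀`. -/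
  level_mem : ∀ i, h i ∈ 𝕀.level ((p ^ e i : ℕ) : ℝ)
  /-- (i), first clause: `h_i ∈ 𝔪^{p^{e_i}}`. -/
  pow_mem : ∀ i, h i ∈ maximalIdeal R ^ p ^ e i
  /-- (i), second clause: `h̄_i ∈ L(𝕀)^{pure}_{p^{e_i}}`. -/
  pure : ∀ i, gradedPiece.mk (maximalIdeal R) (p ^ e i) ⟨h i, pow_mem i⟩ ∈ pureLeading 𝕀 (p ^ e i)
  /-- (ii), «distinct elements». -/
  injective : ∀ e₀ : ℕ, Function.Injective (lgsFamily p h e pow_mem e₀)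
  /-- (ii), «forms a basis»: linearly independent over the residue field … -/
  linearIndependent : ∀ e₀ : ℕ, LinearIndependent (ResidueField R) (lgsFamily p h e pow_mem e₀)
  /-- (ii), «… of `L(𝕀)^{pure}_{p^e}`»: the span is exactly the pure part. -/
  span_eq : ∀ e₀ : ℕ, (Submodule.span (ResidueField R) (Set.range (lgsFamily p h e pow_mem e₀)) :
    Set (gradedPiece (maximalIdeal R) (p ^ e₀))) = pureLeading 𝕀 (p ^ e₀)

/-- **Remark 3.1.3.3 (2)**: the weaker class — condition (i), and «instead of full condition (ii) …
we only require `{h̄_i^{p^{e−e_i}} ; e_i ≤ e}` to be `k`-linearly independent».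
[cite: Kawanoue2007, Rem. 3.1.3.3 (2)] -/
structure IsWeakLGS (p : ℕ) (𝕀 : IdealisticFiltration R) {ι : Type*} (h : ι → R) (e : ι → ℕ) :
    Prop where
  /-- `ℍ ⊂ 𝕀`. -/
  level_mem : ∀ i, h i ∈ 𝕀.level ((p ^ e i : ℕ) : ℝ)
  /-- (i), first clause. -/
  pow_mem : ∀ i, h i ∈ maximalIdeal R ^ p ^ e i
  /-- (i), second clause. -/
  pure : ∀ i, gradedPiece.mk (maximalIdeal R) (p ^ e i) ⟨h i, pow_mem i⟩ ∈ pureLeading 𝕀 (p ^ e i)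
  /-- weak (ii): linear independence only. -/
  linearIndependent : ∀ e₀ : ℕ, LinearIndependent (ResidueField R) (lgsFamily p h e pow_mem e₀)

/-- A leading generator system belongs to the weaker class of Rem. 3.1.3.3 (2).
[cite: Kawanoue2007, Rem. 3.1.3.3 (2)] -/
theorem IsLGS.isWeakLGS {p : ℕ} {𝕀 : IdealisticFiltration R} {ι : Type*} {h : ι → R} {e : ι → ℕ}
    (H : IsLGS p 𝕀 h e) : IsWeakLGS p 𝕀 h e :=
  ⟨H.level_mem, H.pow_mem, H.pure, H.linearIndependent⟩

/-- The members of the family of (ii) lie in the pure part `L(𝕀)^{pure}_{p^e}` (from `span_eq`).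
[cite: Kawanoue2007, Def. 3.1.3.1 (ii)] -/
theorem IsLGS.lgsFamily_mem_pureLeading {p : ℕ} {𝕀 : IdealisticFiltration R} {ι : Type*} {h : ι → R}
    {e : ι → ℕ} (H : IsLGS p 𝕀 h e) (e₀ : ℕ) (i : {i : ι // e i ≤ e₀}) :
    lgsFamily p h e H.pow_mem e₀ i ∈ pureLeading 𝕀 (p ^ e₀) := by
  rw [← H.span_eq e₀]
  exact Submodule.subset_span ⟨i, rfl⟩

/-! ## Def. 3.2.1.1: the invariant `σ` -/

/-- **`l^{pure}_q = dim_k L(𝕀)^{pure}_q`**, typed as the dimension over the residue field of the span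
of the pure part of degree `q` (= the pure part itself when it is a subspace, e.g. `k` perfect).
[cite: Kawanoue2007, Def. 3.2.1.1] -/
def lPure (𝕀 : IdealisticFiltration R) (q : ℕ) : ℕ :=
  Module.finrank (ResidueField R) (Submodule.span (ResidueField R) (pureLeading 𝕀 q))

/-- **The invariant `σ`** [Def. 3.2.1.1]: «`σ = (d − l^{pure}_{p^0}, d − l^{pure}_{p^1}, …, d −
l^{pure}_{p^e}, …)` where `d = dim W`, `l^{pure}_{p^e} = dim_k L(𝕀)^{pure}_{p^e}`. More precisely,
`σ` should be considered as a function `σ : ℤ_{≥0} → ℤ_{≥0}` defined by `σ(e) = d − l^{pure}_{p^e}`».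
Typed with `d` a parameter (`dim W` in print) and values in `ℤ` (in print `l^{pure}_{p^e} ≤ dim W`,
hence `σ(e) ≥ 0` — not proved here). [cite: Kawanoue2007, Def. 3.2.1.1] -/
def sigma (p d : ℕ) (𝕀 : IdealisticFiltration R) : ℕ → ℤ := fun e => (d : ℤ) - (lPure 𝕀 (p ^ e) : ℤ)

/-- Unfolding `σ(e) = d − l^{pure}_{p^e}`. [cite: Kawanoue2007, Def. 3.2.1.1] -/
theorem sigma_apply (p d : ℕ) (𝕀 : IdealisticFiltration R) (e : ℕ) :
    sigma p d 𝕀 e = (d : ℤ) - (lPure 𝕀 (p ^ e) : ℤ) :=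
  rfl

/-- For a leading generator system `ℍ = {(h_i, p^{e_i})}`, condition (ii) gives
`l^{pure}_{p^e} = #{i ; e_i ≤ e}` (the `h̄_i^{p^{e−e_i}}`, `e_i ≤ e`, form a basis of the pure part).
[cite: Kawanoue2007, Def. 3.1.3.1 (ii) with Def. 3.2.1.1] -/
theorem IsLGS.lPure_eq_card {p : ℕ} {𝕀 : IdealisticFiltration R} {ι : Type*} {h : ι → R} {e : ι → ℕ}
    (H : IsLGS p 𝕀 h e) (e₀ : ℕ) [Fintype {i : ι // e i ≤ e₀}] :
    lPure 𝕀 (p ^ e₀) = Fintype.card {i : ι // e i ≤ e₀} := by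
  rw [lPure, ← H.span_eq e₀, Submodule.span_eq]
  exact finrank_span_eq_card (H.linearIndependent e₀)

/-- Hence `σ(e) = d − #{i ; e_i ≤ e}` for a leading generator system.
[cite: Kawanoue2007, Def. 3.1.3.1 (ii) with Def. 3.2.1.1] -/
theorem IsLGS.sigma_eq {p : ℕ} {𝕀 : IdealisticFiltration R} {ι : Type*} {h : ι → R} {e : ι → ℕ}
    (H : IsLGS p 𝕀 h e) (d e₀ : ℕ) [Fintype {i : ι // e i ≤ e₀}] :
    sigma p d 𝕀 e₀ = (d : ℤ) - Fintype.card {i : ι // e i ≤ e₀} := by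
  rw [sigma_apply, H.lPure_eq_card e₀]

end Leading

end Literature.AlgebraicGeometry.Kawanoue2007
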